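import Mathlib
import Literature.MathematicalPhysics.QuantumFieldTheory.Balaban1983to89.B12

/-!
# `Balaban1983to89.B13` — T. Bałaban, *Renormalization group approach to lattice gauge field theories. II. Cluster
expansions*, Commun. Math. Phys. **116**, 1–22 (1988), doi:10.1007/bf01239022.  (Cell numbering: B13 = "[II]" of the
later papers; its only reference is [1] = [Balaban1987RG1] "and references therein", so a numeric reference [n] in
this paper means entry [n] of the list of [Balaban1987RG1]: [6] = [Balaban1983Higgs2] (B2), [13] = B9, [15] = B11,
[16] = [Balaban1985UV3] (B10), [26] = Cammarota, CMP 85 (1982) 517–528, [25] = Brydges (Les Houches 1984), [36] =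
Gallavotti–Martin-Löf–Miracle-Solé (LNP 20, 1973), [50] = Glimm–Jaffe, *Quantum Physics* (1981), [67] = Seiler (LNP 159,
1982), [60] = Kunz–Souillard "manuscript" (unpublished).)  PDF held: `paper:balaban1988-cmp116-rg-ii-cluster`
(journal page = PDF page).

CITATION HEADER (lean-in-tree rule 2026-08-18).  This module is a TYPED SKELETON (statement level) of the published
paper [Balaban1988RG2Cluster] (cell paper B13).  The paper states NO numbered theorem of its own; it states three
lemmas (Lemma 1 p. 9, Lemma 2 p. 11, Lemma 3 p. 20) and closes (p. 22) the proof of Theorem 3 of [Balaban1987RG1].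
Abstract (p. 1), verbatim: *"The fluctuation field integral, constructed in Part I, is represented by the
exponentiated cluster expansion. It is proved that the terms of the expansion satisfy the inductive assumptions. This
completes the construction of the sequence of effective actions in the small field approximation."*  p. 1: *"We prove
also that terms of this expansion satisfy the inductive assumptions formulated in the first paper. Thus we complete
the proof of Theorem 3 of that paper."*  p. 22: *"The above remark completes the proof of the inductive assumptions for
the action A_{k+1}, hence the proof of Theorem I.3."*

WHAT IS REPRODUCED.  Part A (unit `b2b-balaban-r2`): exactly that deliverable — the node "inductive assumptions
(1.1)–(1.22) of [I] at step k ⇒ at step k + 1, in the small-field approximation, under 0 < g_j ≤ γ" — as a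
`def … : Prop` over the carrier `RunData` of `…Balaban1983to89.B12` (whose field `IndAss k` is that predicate), and
the kernel-checked bookkeeping induction `indAss_all` giving the conclusion of Theorem I.3 for one run from the node
and the first step.  Parts B–E (unit `b2b-balaban-b13`, whole paper read from the page renders): the constants of
§§1–2 with the printed restrictions that enter the closing bookkeeping (Part B); a statement-level carrier `StepData`
for ONE renormalization step over the shared `Setup` vocabulary (`LocDomainSys` = the localization domains 𝐃_k, 𝐃_{k+1}
with their tree lengths d_k, d_{k+1}) and Lemmas 1, 2, 3 typed VERBATIM over it (Part C); the paper-internal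
implications kernel-checked exactly as the paper states them (Part D): Lemma 2 ⇐ Lemma 1 + the P^{(k)}-analysis
(p. 10–11), (2.41) + the two "last assumptions" of p. 21 ⇒ (I.1.18) with ½E₀ for the terms of E^{(k+1)}
(`bound118_of_bound241`), the two halves ⇒ (I.1.18) (`bound118_of_halves`, with `δ₀M ≥ κ`), the chain Lemma 3 →
[26]-resummation → (2.41) → (I.1.18) assembled into the clauses this paper delivers for A_{k+1} (`Deliverables`,
`deliverables_of_chain`), the seam to Part A (`smallFieldStep_of_parts`: [I] §§2–5 + [II] + the reader-owned
identification of the clauses with (1.1)–(1.22) ⇒ `SmallFieldStep`), and the edge to `Setup.LocExpansion.ExpDecayBound`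
(`bound118_iff_expDecayBound`); and second-engine real-arithmetic certifications of located proof steps (Part E:
(2.22), (2.28), (2.33) empty case, (2.34), the p. 21 rate identities, the E₀-cancellation in "O(1)C₃ε₁ ≤ ½E₀").
Part F (unit `b2b-balaban-b13-g2`): the scale-transfer step (2.36) p. 19 typed with a general transfer factor ℓ
(`Ineq236With`; the printed claim is ℓ = L/2, `Ineq236Printed`, unproved in print), the cell's PROVED substitute
ℓ = L/a(L), a(L) = 3 + 12/(L − 2) for d = 4 (elementary prose proof with page quotations in
`HOME/b2b-balaban-b13/GEOMETRY-236.md`; its real-arithmetic skeleton kernel-checked: `thmA_accounting`, `corB_of_thmA`,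
`Consts.aL_lt_self_iff`, `Consts.one_lt_transferFactor`), and the closing ledger of pp. 19–21 re-run for a general ℓ
(`Consts.R22gen`, `Consts.rates_of_R22gen`, `Bound238With`, `Bound241With`, `bound118_of_bound241With`,
`deliverables_of_chainWith`): the delivered decay rate κ of (I.1.18) needs only ℓ > 1, which the proved factor
satisfies for every L ≥ 7, hence for every L admitted by [I] (cell GAPS.md G-B13-09R, C-B13-09).
Part G (unit `b2b-balaban-b13-g3`): the log Z^{(k)} half of (I.1.18) (p. 21, by reference to (63) of [16] "and the
discussion after it"; cell GAPS.md G-B13-12, G-adv5-5) — consumed by Parts D/F as the bare hypothesis `hlog` — typed as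
NAMED LEAVES: the per-LM-cube localisation bound `LogHalfBound` (not printed anywhere in the series), the volume bound
`VolBoundK1` ((2.30) at scale k + 1, repaired form), the printed restriction `Consts.R21` ((LM)⁴α₀, … ≤ 1, p. 20) and
the sharpened `Consts.R24sharp` (κ + 1 ≤ δ₀M); kernel-checked: `bound118_of_logHalfBound` (the leaves ⇒ the shape
(I.1.18) with rate r − 1), `bound118_of_logHalfBound_literal` (the literal reading: an ABSOLUTE constant under R21 and a
per-site smallness), `deliverables_of_chainWith_logHalf` / `deliverables_of_chain_logHalf` (`hlog` discharged modulo
the leaves).  The two readings of p. 21's "absolute constant" are recorded in the Part G docstring and in cell GAPS.md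
G-B13-12a; neither is asserted.
NOTHING of the series is asserted: `Lemma1Printed`, `Lemma2Printed`, `Lemma3Printed`, `CammarotaStep` and the fields
`Restr`, `Repr17`, `Analytic`, `GaugeInv` of the carrier are consumed only as hypotheses.  By-reference inputs of the
printed proof that are NOT typed (reader-owned; cell GAPS.md rows G-B13-*): the random-walk expansions of [13]/[15]/[16]
((1.11)–(1.32), (2.7), (2.16)), the combinatorial bounds (1.26)/(2.29) ("simple modification of [26]"), the geometric
inequalities (2.27), (2.30), (2.32), (2.36) on tree lengths of unions of cubes (the cube geometry is abstracted in
`Setup.LocDomainSys`, DIVERGENCE F5; (2.30) and (2.32) are false as printed and repaired in GAPS.md G-B13-07/G-B13-08;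
(2.36) is unproved as printed and is replaced by the proved substitute of Part F, GAPS.md G-B13-09R),
and the exponentiation formula (2.12) [36, 26, 25, 67, 50].  Staged byte-identically in the cell package
`run/shared/lean/pub/pub-balaban/lean/BalabanYm4/Literature/…/B13.lean` (legacy Mathlib-only copy `BalabanYm4/B13.lean`
there, namespace `BalabanYm4.B13`, Part A only).  Companion prose `HOME/b2b-balaban-r2/B13.md` (Part A),
`HOME/b2b-balaban-b13/` (transcript, GAPS/DIVERGENCE rows for Parts B–E).

Promise p. 1: *"The two expansions constructed here are quite general … They can be, and will be, applied in many
other situations, such as for the expressions constructed with the help of more general propagators described in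
[13], or for integrals conditioned to subdomains of the lattice."* (so used in [Balaban1988Convergent] §3 and
[Balaban1989LargeFieldII] §1).
-/

namespace Literature.MathematicalPhysics.QuantumFieldTheory.Balaban1983to89.B13

open Literature.MathematicalPhysics.QuantumFieldTheory.Balaban1983to89

/-! ## Part A. The node delivered by the paper (unit b2b-balaban-r2) -/

/-- What the paper (with §§2–5 of [Balaban1987RG1]) delivers, p. 22 [22] verbatim: *"The above remark completes the
proof of the inductive assumptions for the action A_{k+1}, hence the proof of Theorem I.3."* — the INDUCTIVE STEP in
the small-field approximation for one run `D` with `K` steps: for k < K, if `0 < g_j ≤ γ` for j ≤ k + 1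
(`Setup.Flow.InInterval`) and A_k satisfies (1.1)–(1.22) of [I], then so does A_{k+1}.  Re-check against the renders
(unit b2b-balaban-b13, T10.4): p. 1 [1] *"Thus we complete the proof of Theorem 3 of that paper."*; the hypothesis
`g_k ≤ γ` is used in print at exactly one place, p. 18 [18] (*"Assuming (1/20)γ₂ε₁²/g_k² ≥ (1/20)γ₂ε₁²/γ² ≥ 4κ"*), so
`InInterval γ (k + 1)` (all j ≤ k + 1) is a weaker-hypothesis reading of the same node; the link to Lemma 3 is
`smallFieldStep_of_parts` + `deliverables_of_chain` below. [cite: Balaban1988RG2Cluster, p.22 (proof of Thm I.3)] -/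
def SmallFieldStep (D : B12.RunData) (K : ℕ) (γ : ℝ) : Prop :=
  ∀ k, k < K → D.flow.InInterval γ (k + 1) → D.IndAss k → D.IndAss (k + 1)

/-- Bookkeeping: first step + inductive step ⇒ all steps k ≤ K (the conclusion of Theorem I.3 =
`B12.Thm3Printed`'s innermost clause, for this run).  Pure induction on k. [folklore] -/
theorem indAss_all (D : B12.RunData) (K : ℕ) (γ : ℝ) (h0 : D.IndAss 0) (hstep : SmallFieldStep D K γ)
    (hg : D.flow.InInterval γ K) : ∀ k, k ≤ K → D.IndAss k := by
  intro k hk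
  induction k with
  | zero => exact h0
  | succ n ih =>
    have hnK : n < K := Nat.lt_of_succ_le hk
    exact hstep n hnK (fun j hj => hg j (le_trans hj hk)) (ih (le_of_lt hnK))

/-- Bookkeeping toward `B12.Thm3Printed`: if for fixed admissible constants `c` one γ > 0 serves the first step and
the inductive step of EVERY run, then the innermost clause of Theorem I.3 holds for every run (the form consumed by
`B12.thm1_of_thm3_fixedConsts`). [folklore] -/
theorem thm3_inner_of_step (C : B12.Consts3 → B12.Construction) (c : B12.Consts3) (γ : ℝ)
    (h0 : ∀ P : B12.RunParams, (C c P).flow.InInterval γ P.K → (C c P).IndAss 0)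
    (hstep : ∀ P : B12.RunParams, SmallFieldStep (C c P) P.K γ) :
    ∀ P : B12.RunParams, (C c P).flow.InInterval γ P.K → ∀ k, k ≤ P.K → (C c P).IndAss k :=
  fun P hP => indAss_all (C c P) P.K γ (h0 P hP) (hstep P) hP

/-- The seam between Part A and the paper's internal results (p. 1 [1], verbatim: *"In the first paper of this series we
have considered the fluctuation field integral defined by the k-th renormalization transformation. We have shown there
that the fluctuation field effective action is a small perturbation of the basic quadratic form, in the small field
approximation. This is the main part of the analysis of this integral, and it includes the analysis of
renormalization. Now it remains to construct a localized representation for the new term in the effective action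
defined by the fluctuation field integral. This is done by an application of the exponentiated cluster expansion."*
— docstring corrected by unit b2b-balaban-b13-g3, cell GAPS.md G-pv13-1 / C-B13-10: the p. 1 words quoted here before
were not this paper's; statement and proof unchanged; p. 22 [22]:
*"The above remark completes the proof of the inductive assumptions for the action A_{k+1}"*): for each step k < K, under
`0 < g_j ≤ γ` (j ≤ k + 1) and the inductive assumptions for A_k, [I] §§2–5 deliver `PartI k` (the prepared fluctuation
integral (I.2.12)/(I.2.13)), this paper delivers `PartII k` (in the cell's reading: `Deliverables` below for the step-k
data), and the identification of these clauses with (1.1)–(1.22) of [I] for A_{k+1} (`hbind`, reader-owned — the clauses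
"C^∞ in g_k", the derivative bounds on β_{k+1} (I.1.20)–(I.1.22) and the T^{(k+1)}-invariance of (I.1.3) are NOT visibly
discharged on pp. 19–22: cell GAPS.md G-adv2-6) gives the node `SmallFieldStep`.  Pure logic. [cite: Balaban1988RG2Cluster, p.1 and p.22] -/
theorem smallFieldStep_of_parts (D : B12.RunData) (K : ℕ) (γ : ℝ) (PartI PartII : ℕ → Prop)
    (hI : ∀ k, k < K → D.flow.InInterval γ (k + 1) → D.IndAss k → PartI k)
    (hII : ∀ k, k < K → D.flow.InInterval γ (k + 1) → D.IndAss k → PartI k → PartII k)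
    (hbind : ∀ k, k < K → D.IndAss k → PartI k → PartII k → D.IndAss (k + 1)) :
    SmallFieldStep D K γ :=
  fun k hk hg hA => hbind k hk hA (hI k hk hg hA) (hII k hk hg hA (hI k hk hg hA))

noncomputable section

/-! ## Part B. Constants of §§1–2 and the located restrictions (pp. 3–21) -/

/-- The constants appearing in Lemmas 1–3 and in the closing bookkeeping of §2 (pp. 3–21): `L` = block size of [I]
(p. 251 there: "L an odd, positive integer > 11"), `M` = cube size, `q` = the power in (1.36), `κ, κ₁, δ, δ₀` = decay
rates ((1.26), (1.21), p. 9 "δ > 0 is fixed and small", (1.18)), `E₀, ε₁` of [I], `C₁, C₂` of (1.36), `C₃` = the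
ABSOLUTE constant of (1.39)/(1.43) (§1), `α₀, α₁, α₄, α₅, α₆, γ₂` ((2.18), (2.23), p. 18, (2.22)), `γ` of Theorem I.3,
and `A₁`, `A₂` = the two printed "O(1)" of p. 20 (inside the activity constant C₃) and of (2.41).  Print REUSES the
names `ε₂` (a radius in (1.13) p. 4 vs. the product on p. 19) and `C₃` (§1 vs. the activity constant p. 20); the
p. 19 / p. 20 quantities are `Consts.eps2`, `Consts.C3act` here (cell DIVERGENCE.md D-b13.2). [cite: Balaban1988RG2Cluster, §§1–2 pp.3–21 (constants)] -/
structure Consts where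
  L : ℕ
  q : ℕ
  M : ℝ
  κ : ℝ
  κ₁ : ℝ
  δ : ℝ
  δ₀ : ℝ
  E₀ : ℝ
  ε₁ : ℝ
  C₁ : ℝ
  C₂ : ℝ
  C₃ : ℝ
  α₀ : ℝ
  α₁ : ℝ
  α₄ : ℝ
  α₅ : ℝ
  α₆ : ℝ
  γ₂ : ℝ
  γ : ℝ
  A₁ : ℝ
  A₂ : ℝ

namespace Consts

/-- The `E₀`- and `ε₁`-free kernel `2 C₁ α₄⁻¹ α₆⁻¹ M^q exp C₂κ₁` of the p. 19 product `ε₂` and of the p. 20 activity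
constant (introduced for the bookkeeping `R23_iff`; not a printed name). [cite: Balaban1988RG2Cluster, p.19 (definition of ε₂)] -/
def K₀ (c : Consts) : ℝ := 2 * c.C₁ * c.α₄⁻¹ * c.α₆⁻¹ * c.M ^ c.q * Real.exp (c.C₂ * c.κ₁)

/-- p. 19 [19], verbatim: *"denoting ε₂ = 2E₀ε₁C₁α₄⁻¹α₆⁻¹M^q exp C₂κ₁"* (printed form = `eps2_printed`). [cite: Balaban1988RG2Cluster, p.19 (definition of ε₂)] -/
def eps2 (c : Consts) : ℝ := c.E₀ * c.ε₁ * c.K₀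

/-- The printed product for `ε₂` (p. 19). [cite: Balaban1988RG2Cluster, p.19 (definition of ε₂)] -/
theorem eps2_printed (c : Consts) :
    c.eps2 = 2 * c.E₀ * c.ε₁ * c.C₁ * c.α₄⁻¹ * c.α₆⁻¹ * c.M ^ c.q * Real.exp (c.C₂ * c.κ₁) := by
  unfold eps2 K₀; ring

/-- p. 20 [20], verbatim: *"We define the constant C₃ = 2(L+2)⁴O(1)2E₀C₁α₄⁻¹α₆⁻¹M^q exp C₂κ₁."* — the constant of
Lemma 3 (2.38); `A₁` = the printed O(1) (printed form = `C3act_printed`). [cite: Balaban1988RG2Cluster, p.20 (definition of C₃)] -/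
def C3act (c : Consts) : ℝ := 2 * ((c.L : ℝ) + 2) ^ 4 * c.A₁ * (c.E₀ * c.K₀)

/-- The printed product for the activity constant C₃ (p. 20). [cite: Balaban1988RG2Cluster, p.20 (definition of C₃)] -/
theorem C3act_printed (c : Consts) : c.C3act =
    2 * ((c.L : ℝ) + 2) ^ 4 * c.A₁ * (2 * c.E₀ * c.C₁ * c.α₄⁻¹ * c.α₆⁻¹ * c.M ^ c.q * Real.exp (c.C₂ * c.κ₁)) := by
  unfold C3act K₀; ring

/-- Bookkeeping: `C₃ ε₁ = 2(L+2)⁴ O(1) ε₂` (p. 20 "We leave one factor 2(L+2)⁴O(1)ε₂"). [cite: Balaban1988RG2Cluster, p.20 (definition of C₃)] -/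
theorem C3act_mul_eps1 (c : Consts) : c.C3act * c.ε₁ = 2 * ((c.L : ℝ) + 2) ^ 4 * c.A₁ * c.eps2 := by
  unfold C3act eps2; ring

/-- Restriction p. 18 [18], verbatim: *"Assuming 2E₀ε₁C₁α₄⁻¹α₆⁻¹M^q exp C₂κ₁ exp 5κ ≤ 1, we have (2.28)"* (cell census
R15). [cite: Balaban1988RG2Cluster, p.18 (before (2.28))] -/
def R15 (c : Consts) : Prop := c.eps2 * Real.exp (5 * c.κ) ≤ 1

/-- Restriction p. 18 [18], verbatim: *"Assuming (1/20)γ₂ε₁²/g_k² ≥ (1/20)γ₂ε₁²/γ² ≥ 4κ"* — the printed form with the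
constant 4 of (2.32); the one place where `g_k ≤ γ` of Theorem I.3 enters (cell census R16; with the repaired (2.32),
GAPS.md G-B13-08, the constant is 18: `R16repaired`). [cite: Balaban1988RG2Cluster, p.18 (after (2.32))] -/
def R16 (c : Consts) : Prop := 4 * c.κ ≤ c.γ₂ * c.ε₁ ^ 2 / c.γ ^ 2 / 20

/-- The same restriction with the constant forced by the corrected geometric inequality (2.32)
(`Σ_i d_k(Y_i) + 18·M⁻⁴|Z₀∖Y₀| ≥ d_k(Z₀)`, cell GAPS.md G-B13-08); not printed. [cite: Balaban1988RG2Cluster, p.18 (after (2.32))] -/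
def R16repaired (c : Consts) : Prop := 18 * c.κ ≤ c.γ₂ * c.ε₁ ^ 2 / c.γ ^ 2 / 20

/-- "Last assumption" 1, p. 21 [21], verbatim: *"At first we assume that (1 − 10δ)½L = 1, or δ = (1/10)(1 − 2L⁻¹)."*
(cell census R22; `R22_iff_delta`, `delta_bounds_of_R22`). [cite: Balaban1988RG2Cluster, p.21 (after (2.41))] -/
def R22 (c : Consts) : Prop := (1 - 10 * c.δ) * ((c.L : ℝ) / 2) = 1

/-- "Last assumption" 2, p. 21 [21], verbatim: *"Next, we assume that O(1)C₃ε₁ ≤ ½E₀. In fact this assumption is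
unessential, because the constant C₃ε₁ is small anyway, and we can take E₀ such, that the assumption is satisfied."*
(cell census R23; since C₃ ∝ E₀ the condition does not involve E₀ at all — `R23_iff`, GAPS.md G-adv2-5). [cite: Balaban1988RG2Cluster, p.21 (after (2.41))] -/
def R23 (c : Consts) : Prop := c.A₂ * c.C3act * c.ε₁ ≤ c.E₀ / 2

/-- Restriction p. 21 [21], verbatim: *"We define ½E₀ as equal to this constant, and we take M sufficiently large, so
that δ₀M ≥ κ."* (cell census R24). [cite: Balaban1988RG2Cluster, p.21 (closing paragraph)] -/
def R24 (c : Consts) : Prop := c.κ ≤ c.δ₀ * c.M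

/-- Second engine for R22: `(1 − 10δ)½L = 1 ⟺ δ = (1/10)(1 − 2L⁻¹)` (p. 21, the "or"). [cite: Balaban1988RG2Cluster, p.21 (after (2.41))] -/
theorem R22_iff_delta (c : Consts) (hL : (c.L : ℝ) ≠ 0) : c.R22 ↔ c.δ = (1 - 2 / (c.L : ℝ)) / 10 := by
  unfold R22
  constructor
  · intro h
    have h' : c.δ * (c.L : ℝ) = ((c.L : ℝ) - 2) / 10 := by linear_combination (-1 / 5 : ℝ) * h
    field_simp
    linear_combination 10 * h'
  · intro h
    rw [h]
    field_simp
    ring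

/-- Consequence of R22 used silently on p. 21: with `L > 2` (in [I]: L odd > 11) one has `0 < δ < 1/10`, so the rates
`(1 − jδ)`, j ≤ 10, of (2.18)–(2.41) are positive. [cite: Balaban1988RG2Cluster, p.21 (after (2.41))] -/
theorem delta_bounds_of_R22 (c : Consts) (hL : 2 < (c.L : ℝ)) (h : c.R22) : 0 < c.δ ∧ c.δ < 1 / 10 := by
  unfold R22 at h
  have hL0 : 0 < (c.L : ℝ) := by linarith
  have h' : c.δ * (c.L : ℝ) = ((c.L : ℝ) - 2) / 10 := by linear_combination (-1 / 5 : ℝ) * h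
  constructor
  · by_contra hc
    rw [not_lt] at hc
    have : c.δ * (c.L : ℝ) ≤ 0 := mul_nonpos_of_nonpos_of_nonneg hc hL0.le
    linarith
  · by_contra hc
    rw [not_lt] at hc
    have : (1 / 10 : ℝ) * (c.L : ℝ) ≤ c.δ * (c.L : ℝ) := mul_le_mul_of_nonneg_right hc hL0.le
    linarith

/-- The rate slip located at (2.39) p. 21 (cell GAPS.md G-B13-11): under R22 the rate `(1 − 9δ)½L` equals `1 + ½δL`,
not `1`, so the merging factor obtained from (2.27) is `exp 5(1 + ½δL)κ` per extra domain rather than the printed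
`exp 5κ` (absorbed by "ε₁ sufficiently small"; conclusion unaffected).  Kernel-checked arithmetic. [cite: Balaban1988RG2Cluster, (2.39) p.21] -/
theorem rate239_of_R22 (c : Consts) (h : c.R22) :
    (1 - 9 * c.δ) * ((c.L : ℝ) / 2) = 1 + c.δ * ((c.L : ℝ) / 2) := by
  unfold R22 at h
  linear_combination h

/-- G-adv2-5 made formal: since the activity constant C₃ carries the factor E₀, the "last assumption" `O(1)C₃ε₁ ≤ ½E₀`
is, for E₀ > 0, the E₀-free smallness condition `O(1)·2(L+2)⁴O(1)·K₀·ε₁ ≤ ½` on ε₁. [cite: Balaban1988RG2Cluster, p.21 (after (2.41))] -/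
theorem R23_iff (c : Consts) (hE : 0 < c.E₀) :
    c.R23 ↔ c.A₂ * (2 * ((c.L : ℝ) + 2) ^ 4 * c.A₁ * c.K₀) * c.ε₁ ≤ 1 / 2 := by
  unfold R23 C3act
  have key : c.A₂ * (2 * ((c.L : ℝ) + 2) ^ 4 * c.A₁ * (c.E₀ * c.K₀)) * c.ε₁ =
      c.E₀ * (c.A₂ * (2 * ((c.L : ℝ) + 2) ^ 4 * c.A₁ * c.K₀) * c.ε₁) := by ring
  rw [key]
  constructor
  · intro h
    by_contra hc
    rw [not_le] at hc
    have := mul_lt_mul_of_pos_left hc hE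
    linarith
  · intro h
    have := mul_le_mul_of_nonneg_left h hE.le
    linarith

end Consts

/-! ## Part C. One renormalization step: carrier and the three lemmas, verbatim -/

/-- Statement-level carrier for ONE step k → k + 1 of §§1–2, over the shared `Setup` vocabulary: `Dk`, `Dk1` = the
localization domains 𝐃_k, 𝐃_{k+1} with tree lengths d_k, d_{k+1} (`Setup.LocDomainSys`; B12 p. 257); `volk Y` =
`M⁻⁴|Y|` = the number of cubes of π_k in Y; `Φ` = (complexified) configurations (𝐔, 𝐉, B) (external gauge field,
external current, fluctuation field B on bonds `Bond` of T^{(k)}, read off by `Bv`); `sp1 Y` = the space (1.34)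
*"Uᶜ_{k+1}(Y, (1+β)α₀, (1+β)α₁, α₀) × {B : |B| < ε₁g_k⁻¹ on Y}"*; `sp2 X` = *"the space Uᶜ_{k+1}(X, α₀, α₁)"* of p. 15
(B arbitrary); `Vp Y` = V′_k(Y, 𝐔, 𝐉, B) of (1.33)–(1.35); `V Y` = V_k(Y, 𝐔, 𝐉, B) of (1.41); `Q Y φ b b'` = the matrix
elements Q(Y, B, b, b′) of (1.42) (zero unless b, b′ ⊂ Y); `Vpp Y` = V″_k(Y, B) of (1.42); `H Z` = the activity H(Z),
Z ∈ 𝐃_{k+1}, of (2.9) as a function of (𝐔, 𝐉); `Ek1 X` = E^{(k+1)}(X) of (2.13); `Elog X` = the terms localized in X of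
`log Z^{(k)}(U_{k+1}) − log Z^{(k)}(1)` (p. 21, via (63) of [16]); `Analytic f s` = "f is analytic on s", `GaugeInv f` =
"f is gauge invariant w.r.t. the simultaneous transformations (I.3.29)" (reader-owned predicates); `Repr17` = "the
representation (I.1.6)/(I.1.7) for j = k + 1 is achieved" (p. 11, p. 21); `Restr` = *"all the above restrictions on the
constants M, κ, κ₁, α₀, α₁, α₄, α₆, γ₂, γ, ε₁"* of Lemma 3 (cell census R1–R24, GAPS.md C-adv2-3 = their admissible
order).  Schematic: cube geometry, measures, operators and the polymer combinatorics (2.11)–(2.13) are not modelled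
(cell DIVERGENCE.md D-b13.1). [cite: Balaban1988RG2Cluster, §1 (1.33)–(1.42) pp.9–11 and §2 (2.9)–(2.13) pp.14–15] -/
structure StepData where
  Dk : LocDomainSys
  Dk1 : LocDomainSys
  volk : Dk.Dom → ℕ
  Φ : Type
  Bond : Type
  [finBond : Fintype Bond]
  sp1 : Dk.Dom → Set Φ
  sp2 : Dk1.Dom → Set Φ
  Bv : Φ → Bond → ℂ
  Vp : Dk.Dom → Φ → ℂ
  V : Dk.Dom → Φ → ℂ
  Q : Dk.Dom → Φ → Bond → Bond → ℂ
  Vpp : Dk.Dom → Φ → ℂ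
  H : Dk1.Dom → Φ → ℂ
  Ek1 : Dk1.Dom → Φ → ℂ
  Elog : Dk1.Dom → Φ → ℂ
  Analytic : (Φ → ℂ) → Set Φ → Prop
  GaugeInv : (Φ → ℂ) → Prop
  Repr17 : Prop
  Restr : Prop

namespace StepData

/-- The quadratic form `½⟨Q(Y, B)B, B⟩ = ½ Σ_{b,b′} Q(Y, B, b, b′) B(b) B(b′)` of (1.42) p. 11. [cite: Balaban1988RG2Cluster, (1.42) p.11] -/
def quadForm (S : StepData) (Y : S.Dk.Dom) (φ : S.Φ) : ℂ :=
  haveI := S.finBond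
  (1 / 2 : ℂ) * ∑ b : S.Bond, ∑ b' : S.Bond, S.Q Y φ b b' * S.Bv φ b * S.Bv φ b'

/-- The terms of the effective action A_{k+1} localized in X ∈ 𝐃_{k+1} in the representation (I.1.6): p. 21 [21] *"The
effective action in (I.1.6) is obtained by adding to the above action the expression [log Z^{(k)}(U_{k+1}) −
log Z^{(k)}(1)] … We gather all terms in the expansions, localized in X"* — `E^{(k+1)}(X) + Elog(X)`. [cite: Balaban1988RG2Cluster, p.21 (closing paragraph)] -/
def Etot (S : StepData) (X : S.Dk1.Dom) (φ : S.Φ) : ℂ := S.Ek1 X φ + S.Elog X φ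

end StepData

/-- A bound of the shape (I.1.18) = [Balaban1987RG1] (1.18) p. 263 (*"|E^{(j)}(X, g_{j−1}, 𝐔, 𝐉)| ≤ E₀ exp(−κ d_j(X))"*
on `Uᶜ_j(X, α₀, α₁)`) for a family `E` localized over a `Setup.LocDomainSys`, uniformly on X-dependent spaces `sp X`:
the X-dependent-domain form of `Setup.LocExpansion.ExpDecayBound` (`bound118_iff_expDecayBound`) and the shape of
`Step.SFHyp.bound118` at one j. [cite: Balaban1988RG2Cluster, p.14 ("we have to prove the bounds (I.1.18)")] -/
def Bound118 (D : LocDomainSys) {Φ : Type*} (sp : D.Dom → Set Φ) (E : D.Dom → Φ → ℂ) (E₀ κ : ℝ) : Prop :=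
  ∀ X φ, φ ∈ sp X → ‖E X φ‖ ≤ E₀ * Real.exp (-κ * D.dj X)

/-- Edge to the shared vocabulary: for a constant family of spaces, `Bound118` IS `Setup.LocExpansion.ExpDecayBound`
(definitionally). [folklore] -/
theorem bound118_iff_expDecayBound {Φ : Type*} (ℰ : LocExpansion Φ) (𝒰 : Set Φ) (E₀ κ : ℝ) :
    Bound118 ℰ.sys (fun _ => 𝒰) ℰ.E E₀ κ ↔ ℰ.ExpDecayBound 𝒰 E₀ κ := Iff.rfl

/-- The bound (1.36) p. 9 [9], verbatim: *"|V′_k(Y, 𝐔, 𝐉, B)| ≤ E₀ε₁C₁M^q exp C₂κ₁ exp(−(1 − 2δ)κd_k(Y))"*, for a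
family `F` on the spaces (1.34) (used for V′_k in Lemma 1 and for V″_k in Lemma 2). [cite: Balaban1988RG2Cluster, (1.36) p.9] -/
def Bound136 (S : StepData) (c : Consts) (F : S.Dk.Dom → S.Φ → ℂ) : Prop :=
  ∀ Y φ, φ ∈ S.sp1 Y → ‖F Y φ‖ ≤
    c.E₀ * c.ε₁ * c.C₁ * c.M ^ c.q * Real.exp (c.C₂ * c.κ₁) * Real.exp (-((1 - 2 * c.δ) * c.κ * S.Dk.dj Y))

/-- **Lemma 1** (p. 9 [9]), verbatim: *"The second expression in the fluctuation field action in (I.2.13) is represented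
as the sum (1.33) E_k(U_k(exp iB′V^{(k)})) − E_k(U_k(V^{(k)})) = Σ_{Y∈𝐃_k} V′_k(Y, U_{k+1}, B). For each term in the sum
there exists a function V′_k(Y, 𝐔, 𝐉, B), defined and analytic on the space (1.34) Uᶜ_{k+1}(Y, (1+β)α₀, (1+β)α₁, α₀) ×
{B : |B| < ε₁g_k⁻¹ on Y}, i.e. it depends on configurations 𝐔, 𝐉, B restricted to the interior of Y, and such that
(1.35) V′_k(Y, U_{k+1}, B) = V′_k(Y, U_{k+1}, J_{k+1}, B). There exist absolute constants C₁, C₂, q, for which (1.36)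
|V′_k(Y, 𝐔, 𝐉, B)| ≤ E₀ε₁C₁M^q exp C₂κ₁ exp(−(1 − 2δ)κd_k(Y))."*  Typed: analyticity on (1.34) ∧ (1.36) (the identities
(1.33)/(1.35) define `Vp` and are carried by the carrier).  Printed proof pp. 2–9 by the expansions of [13], [15], [16]
(cell GAPS.md G-B13-01…06). [cite: Balaban1988RG2Cluster, Lemma 1 p.9] -/
def Lemma1Printed (S : StepData) (c : Consts) : Prop :=
  (∀ Y, S.Analytic (S.Vp Y) (S.sp1 Y)) ∧ Bound136 S c S.Vp

/-- The representation (1.42) p. 11 [11], verbatim: *"This function is a sum of two terms (1.42) V_k(Y, B) =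
½⟨Q(Y, B), B, B⟩ + V″_k(Y, B). The first is a quadratic form in B, with an operator depending on B also."* [cite: Balaban1988RG2Cluster, (1.42) p.11] -/
def Repr142 (S : StepData) : Prop :=
  ∀ Y φ, φ ∈ S.sp1 Y → S.V Y φ = S.quadForm Y φ + S.Vpp Y φ

/-- The bound (1.43) p. 11 [11], verbatim: *"The matrix elements of the operator of the quadratic form satisfy the bound
(1.43) |Q(Y, B, b, b′)| ≤ C₃ε₁M⁴ exp C₂κ₁ exp(−⅛(κ₁ − 1)d_k(Y) − ½(κ₁ − 1)M⁻⁴|Y|)"* (C₃ = the absolute constant of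
(1.39)). [cite: Balaban1988RG2Cluster, (1.43) p.11] -/
def Bound143 (S : StepData) (c : Consts) : Prop :=
  ∀ Y φ (b b' : S.Bond), φ ∈ S.sp1 Y → ‖S.Q Y φ b b'‖ ≤
    c.C₃ * c.ε₁ * c.M ^ 4 * Real.exp (c.C₂ * c.κ₁) *
      Real.exp (-((c.κ₁ - 1) / 8 * S.Dk.dj Y + (c.κ₁ - 1) / 2 * (S.volk Y : ℝ)))

/-- **Lemma 2** (p. 11 [11]), verbatim: *"The fluctuation field action is represented as the sum (1.41)
P^{(k)}(g_k, U_{k+1}, B) + {⋯} = Σ_{Y∈𝐃_k} V_k(Y, U_{k+1}, B). For each term in the sum there exists a function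
V_k(Y, 𝐔, 𝐉, B), defined and analytic on the space (1.34), and satisfying the corresponding equality (1.35). This function
is a sum of two terms (1.42) V_k(Y, B) = ½⟨Q(Y, B), B, B⟩ + V″_k(Y, B). The first is a quadratic form in B, with an
operator depending on B also. The matrix elements of the operator of the quadratic form satisfy the bound (1.43) …, and
the function V″_k(Y, B) satisfies the bound (1.36). The functions V_k(Y, 𝐔, 𝐉, B), and both terms in (1.42), are gauge
invariant with respect to the simultaneous gauge transformations (I.3.29), for Gᶜ-valued transformations u in a
sufficiently small neighborhood of all G-valued transformations."*  Typed: analyticity ∧ (1.42) ∧ (1.43) ∧ (1.36) for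
V″_k ∧ gauge invariance of the three functions.  Printed proof: Lemma 1 + pp. 10–11 (the P^{(k)} part; gauge invariance
"a consequence of gauge invariance of the whole construction in [1]", by assertion — cell GAPS.md G-B13-06). [cite: Balaban1988RG2Cluster, Lemma 2 p.11] -/
def Lemma2Printed (S : StepData) (c : Consts) : Prop :=
  (∀ Y, S.Analytic (S.V Y) (S.sp1 Y)) ∧ Repr142 S ∧ Bound143 S c ∧ Bound136 S c S.Vpp ∧
    (∀ Y, S.GaugeInv (S.V Y) ∧ S.GaugeInv (S.quadForm Y) ∧ S.GaugeInv (S.Vpp Y))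

/-- The bound (2.38) of Lemma 3 (p. 20 [20]), verbatim: *"|H(Z)| ≤ C₃ε₁ exp(−(1 − 8δ)½Lκd_{k+1}(Z))"*, uniformly on the
space Uᶜ_{k+1}(·, α₀, α₁) of p. 15 (reading: stated on `sp2 Z`; print bounds (2.14) "as an analytic function of (𝐔, 𝐉)
in the space Uᶜ_{k+1}(X, α₀, α₁)", Z ⊂ X). [cite: Balaban1988RG2Cluster, (2.38) p.20] -/
def Bound238 (S : StepData) (c : Consts) : Prop :=
  ∀ Z φ, φ ∈ S.sp2 Z → ‖S.H Z φ‖ ≤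
    c.C3act * c.ε₁ * Real.exp (-((1 - 8 * c.δ) * ((c.L : ℝ) / 2) * c.κ * S.Dk1.dj Z))

/-- **Lemma 3** (p. 20 [20]), verbatim: *"Under all the above restrictions on the constants M, κ, κ₁, α₀, α₁, α₄, α₆,
γ₂, γ, ε₁, the activity H(Z) for a localization domain Z ∈ 𝐃_{k+1} satisfies the inequality (2.38) |H(Z)| ≤ C₃ε₁
exp(−(1 − 8δ)½Lκd_{k+1}(Z))."*  `S.Restr` = the restrictions (cell census R1–R24).  Printed proof pp. 12–20 (cell
GAPS.md G-B13-07…10: (2.16) by assertion, (2.29) by reference to [26], (2.30)/(2.32) false as printed with stated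
repairs, (2.36) unproved). [cite: Balaban1988RG2Cluster, Lemma 3 p.20] -/
def Lemma3Printed (S : StepData) (c : Consts) : Prop := S.Restr → Bound238 S c

/-- The bound (2.41) p. 21 [21], verbatim: *"|E^{(k+1)}(X)| ≤ O(1)C₃ε₁ exp(−(1 − 10δ)½Lκd_{k+1}(X))"* (`A₂` = the
printed O(1)), on the space Uᶜ_{k+1}(X, α₀, α₁). [cite: Balaban1988RG2Cluster, (2.41) p.21] -/
def Bound241 (S : StepData) (c : Consts) : Prop :=
  ∀ X φ, φ ∈ S.sp2 X → ‖S.Ek1 X φ‖ ≤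
    c.A₂ * c.C3act * c.ε₁ * Real.exp (-((1 - 10 * c.δ) * ((c.L : ℝ) / 2) * c.κ * S.Dk1.dj X))

/-- The by-reference resummation step pp. 20–21 [20–21]: *"The above lemma implies that sufficient conditions for
convergence of the series (2.12), (2.13) are satisfied, see [26, 67, 25, 50]. … The series (2.13), defining E^{(k+1)}(X),
is estimated in the standard way … (2.39) … To the above sum we can repeat all the considerations and bounds of the
paper [26], for κ sufficiently large, and ε₁ sufficiently small. We obtain (2.40) … (2.41)"* — (2.38) ⇒ (2.41), entered
as a hypothesis ([26] = Cammarota, CMP 85 (1982); cell GAPS.md G-B13-11, CITED-FACTS X04). [cite: Balaban1988RG2Cluster, (2.39)–(2.41) p.21] -/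
def CammarotaStep (S : StepData) (c : Consts) : Prop := Bound238 S c → Bound241 S c

/-- The clauses of the inductive hypothesis of [I] for A_{k+1} that this paper states it delivers (p. 11 Lemma 2 and
p. 21: the representation (I.1.6)/(I.1.7); p. 15 [15]: *"Thus the activities in (2.13), and the whole sum E^{(k+1)}(X),
are analytic functions of (𝐔, 𝐉), on the space Uᶜ_{k+1}(X, α₀, α₁). This is the analyticity statement in the inductive
assumptions."*; p. 21 [21]: *"This yields the bounds (I.1.18) for terms of the effective action in the representation
(I.1.6) also."*; pp. 21–22: gauge invariance (I.1.19) *"by Lemma 2, and the transformation properties of the operators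
in (2.14) … see (3.28)–(3.34) [13] … We extend them to constant functions on whole orbits"*). [cite: Balaban1988RG2Cluster, pp.15, 21–22] -/
structure Deliverables (S : StepData) (c : Consts) : Prop where
  repr : S.Repr17
  analytic : ∀ X, S.Analytic (S.Etot X) (S.sp2 X)
  bound : Bound118 S.Dk1 S.sp2 S.Etot c.E₀ c.κ
  gauge : ∀ X, S.GaugeInv (S.Etot X)

/-! ## Part D. The paper-internal implications, kernel-checked -/

/-- Lemma 2 ⇐ Lemma 1 + the P^{(k)}-analysis of pp. 10–11, as the paper structures it (p. 9: *"The results obtained for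
the expression in the curly bracket {⋯} can be summarized as follows. Lemma 1"*; p. 11: the P^{(k)} part is the
quadratic form with (1.43), and V″_k := V′_k satisfies (1.36) by Lemma 1).  Pure bookkeeping. [cite: Balaban1988RG2Cluster, pp.9–11 (Lemmas 1, 2)] -/
theorem lemma2_of_lemma1 (S : StepData) (c : Consts) (h1 : Lemma1Printed S c) (hVpp : S.Vpp = S.Vp)
    (hrepr : Repr142 S) (hQ : Bound143 S c) (hVan : ∀ Y, S.Analytic (S.V Y) (S.sp1 Y))
    (hG : ∀ Y, S.GaugeInv (S.V Y) ∧ S.GaugeInv (S.quadForm Y) ∧ S.GaugeInv (S.Vpp Y)) :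
    Lemma2Printed S c := by
  refine ⟨hVan, hrepr, hQ, ?_, hG⟩
  rw [hVpp]
  exact h1.2

/-- p. 21 [21], verbatim: *"The inequality (2.41) and the assumptions imply the inequality (I.1.18), with ½E₀ instead of
E₀, for the terms of the effective action E^{(k+1)} in (I.1.3)."* — kernel-checked: (2.41) ∧ `(1 − 10δ)½L = 1` ∧
`O(1)C₃ε₁ ≤ ½E₀` ⇒ `|E^{(k+1)}(X)| ≤ ½E₀ exp(−κ d_{k+1}(X))`. [cite: Balaban1988RG2Cluster, p.21 (after (2.41))] -/
theorem bound118_of_bound241 (S : StepData) (c : Consts) (h241 : Bound241 S c) (h22 : c.R22) (h23 : c.R23) :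
    Bound118 S.Dk1 S.sp2 S.Ek1 (c.E₀ / 2) c.κ := by
  intro X φ hφ
  have hrate : (1 - 10 * c.δ) * ((c.L : ℝ) / 2) * c.κ * S.Dk1.dj X = c.κ * S.Dk1.dj X := by
    have h22' : (1 - 10 * c.δ) * ((c.L : ℝ) / 2) = 1 := h22
    rw [h22', one_mul]
  have h23' : c.A₂ * c.C3act * c.ε₁ ≤ c.E₀ / 2 := h23
  have h := h241 X φ hφ
  rw [hrate] at h
  have hexp : 0 ≤ Real.exp (-(c.κ * S.Dk1.dj X)) := (Real.exp_pos _).le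
  calc ‖S.Ek1 X φ‖ ≤ c.A₂ * c.C3act * c.ε₁ * Real.exp (-(c.κ * S.Dk1.dj X)) := h
    _ ≤ c.E₀ / 2 * Real.exp (-(c.κ * S.Dk1.dj X)) := mul_le_mul_of_nonneg_right h23' hexp
    _ = c.E₀ / 2 * Real.exp (-c.κ * S.Dk1.dj X) := by rw [neg_mul]

/-- p. 21 [21]: the two halves of (I.1.18) — the E^{(k+1)} terms with `½E₀` and rate κ, and the terms of
`log Z^{(k)}(U_{k+1}) − log Z^{(k)}(1)` which *"satisf[y] the bound (I.1.18) with κ replaced by δ₀M, and with an absolute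
constant instead of E₀. We define ½E₀ as equal to this constant, and we take M sufficiently large, so that δ₀M ≥ κ"* —
add up to (I.1.18) with E₀ and κ (uses d_{k+1}(X) ≥ 0, `Setup.LocDomainSys.dj_nonneg`).  Real arithmetic. [cite: Balaban1988RG2Cluster, p.21 (closing paragraph)] -/
theorem bound118_of_halves {Φ : Type*} (D : LocDomainSys) (sp : D.Dom → Set Φ) (E E₁ E₂ : D.Dom → Φ → ℂ)
    (E₀ κ κ' : ℝ) (hE₀ : 0 ≤ E₀) (hκ : κ ≤ κ') (hsum : ∀ X φ, φ ∈ sp X → E X φ = E₁ X φ + E₂ X φ)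
    (h1 : Bound118 D sp E₁ (E₀ / 2) κ) (h2 : Bound118 D sp E₂ (E₀ / 2) κ') : Bound118 D sp E E₀ κ := by
  intro X φ hφ
  have hd : 0 ≤ D.dj X := D.dj_nonneg X
  have hexp : Real.exp (-κ' * D.dj X) ≤ Real.exp (-κ * D.dj X) :=
    Real.exp_le_exp.mpr (mul_le_mul_of_nonneg_right (neg_le_neg hκ) hd)
  have hb1 := h1 X φ hφ
  have hb2 := h2 X φ hφ
  have hE2 : 0 ≤ E₀ / 2 := by linarith
  have hb2' : ‖E₂ X φ‖ ≤ E₀ / 2 * Real.exp (-κ * D.dj X) := le_trans hb2 (mul_le_mul_of_nonneg_left hexp hE2)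
  rw [hsum X φ hφ]
  calc ‖E₁ X φ + E₂ X φ‖ ≤ ‖E₁ X φ‖ + ‖E₂ X φ‖ := norm_add_le _ _
    _ ≤ E₀ / 2 * Real.exp (-κ * D.dj X) + E₀ / 2 * Real.exp (-κ * D.dj X) := add_le_add hb1 hb2'
    _ = E₀ * Real.exp (-κ * D.dj X) := by ring

/-- The chain of §2 assembled exactly as printed (pp. 20–22): the restrictions + Lemma 3 + the [26]-resummation +
the two "last assumptions" + the log Z^{(k)} half with `δ₀M ≥ κ` + the analyticity (p. 15) and gauge-invariance
(pp. 21–22) statements + the representation (I.1.7) ⇒ the delivered clauses for A_{k+1}.  Every non-arithmetical input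
is a named hypothesis. [cite: Balaban1988RG2Cluster, pp.20–22 (Lemma 3 to Thm I.3)] -/
theorem deliverables_of_chain (S : StepData) (c : Consts) (hR : S.Restr) (h3 : Lemma3Printed S c)
    (h26 : CammarotaStep S c) (h22 : c.R22) (h23 : c.R23) (h24 : c.R24) (hE₀ : 0 ≤ c.E₀)
    (hlog : Bound118 S.Dk1 S.sp2 S.Elog (c.E₀ / 2) (c.δ₀ * c.M)) (hrepr : S.Repr17)
    (han : ∀ X, S.Analytic (S.Etot X) (S.sp2 X)) (hg : ∀ X, S.GaugeInv (S.Etot X)) :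
    Deliverables S c where
  repr := hrepr
  analytic := han
  bound := bound118_of_halves S.Dk1 S.sp2 S.Etot S.Ek1 S.Elog c.E₀ c.κ (c.δ₀ * c.M) hE₀ h24
    (fun _ _ _ => rfl) (bound118_of_bound241 S c (h26 (h3 hR)) h22 h23) hlog
  gauge := hg

/-! ## Part E. Second-engine certifications of located proof steps (real arithmetic) -/

/-- (2.22) p. 16 [16] certified (Chebyshev): on the support of `χ({|B(b)| ≥ ε₁/g_k})` one has
`1 ≤ exp(½γ₂(|B(b)|² − ε₁²/g_k²))` for γ₂ ≥ 0, whence *"χ_{k,Y₀}(B)χᶜ_{k,P}(B) ≤ exp(−½γ₂(ε₁²/g_k²)|P| + ½γ₂‖PB‖²)"*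
factor by factor. [cite: Balaban1988RG2Cluster, (2.22) p.16] -/
theorem indicator_le_exp_222 (x r γ₂ : ℝ) (hγ : 0 ≤ γ₂) (hr : 0 ≤ r) :
    (if r ≤ |x| then (1 : ℝ) else 0) ≤ Real.exp (γ₂ / 2 * (x ^ 2 - r ^ 2)) := by
  split_ifs with h
  · have hx2 : r ^ 2 ≤ x ^ 2 := by
      calc r ^ 2 ≤ |x| ^ 2 := pow_le_pow_left₀ hr h 2
        _ = x ^ 2 := sq_abs x
    have h0 : 0 ≤ γ₂ / 2 * (x ^ 2 - r ^ 2) := mul_nonneg (by linarith) (by linarith)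
    linarith [Real.add_one_le_exp (γ₂ / 2 * (x ^ 2 - r ^ 2))]
  · exact (Real.exp_pos _).le

/-- (2.27)–(2.28) p. 18 [18] certified: if the n ≥ 1 factors are `A exp(−r d_k(Y))` with `A exp 5r′ ≤ 1` for some
r′ ≥ r ≥ 0 (print: A = 2E₀ε₁C₁α₄⁻¹α₆⁻¹M^q exp C₂κ₁, r = (1 − 4δ)κ ≤ κ = r′, restriction R15) and (2.27)
`Σ_{Y∈D}(d_k(Y) + 5) ≥ d_k(Y₀) + 5` holds, then `Π_{Y∈D} A exp(−r d_k(Y)) ≤ A exp(−r d_k(Y₀))` — the passage from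
(2.26) to (2.28) after extracting `α₆ exp(−δκd_k(Y))` from each factor. [cite: Balaban1988RG2Cluster, (2.27)–(2.28) p.18] -/
theorem prod_bound_228 {ι : Type*} (s : Finset ι) (hs : s.Nonempty) (d : ι → ℝ) (A r r' d₀ : ℝ)
    (hA : 0 ≤ A) (hr : 0 ≤ r) (hrr : r ≤ r') (hsmall : A * Real.exp (5 * r') ≤ 1)
    (h227 : d₀ + 5 ≤ ∑ i ∈ s, (d i + 5)) :
    ∏ i ∈ s, (A * Real.exp (-(r * d i))) ≤ A * Real.exp (-(r * d₀)) := by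
  classical
  obtain ⟨m, hm⟩ : ∃ m, s.card = m + 1 := Nat.exists_eq_succ_of_ne_zero (Finset.card_pos.mpr hs).ne'
  rw [Finset.prod_mul_distrib, Finset.prod_const, ← Real.exp_sum, hm]
  have hsum5 : ∑ i ∈ s, (d i + 5) = ∑ i ∈ s, d i + 5 * (s.card : ℝ) := by
    rw [Finset.sum_add_distrib, Finset.sum_const, nsmul_eq_mul]; ring
  have hcard : (s.card : ℝ) = m + 1 := by rw [hm]; push_cast; ring
  have hS : d₀ - 5 * (m : ℝ) ≤ ∑ i ∈ s, d i := by rw [hsum5, hcard] at h227; linarith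
  have hneg : ∑ i ∈ s, -(r * d i) ≤ -(r * d₀) + (m : ℝ) * (5 * r) := by
    rw [Finset.sum_neg_distrib, ← Finset.mul_sum]
    have := mul_le_mul_of_nonneg_left hS hr
    nlinarith
  have hexp : Real.exp (∑ i ∈ s, -(r * d i)) ≤ Real.exp (-(r * d₀)) * Real.exp (5 * r) ^ m := by
    rw [← Real.exp_nat_mul, ← Real.exp_add]
    exact Real.exp_le_exp.mpr hneg
  have hsmall' : A * Real.exp (5 * r) ≤ 1 := by
    refine le_trans (mul_le_mul_of_nonneg_left (Real.exp_le_exp.mpr (by linarith)) hA) hsmall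
  have hpow : (A * Real.exp (5 * r)) ^ m ≤ 1 := pow_le_one₀ (by positivity) hsmall'
  calc A ^ (m + 1) * Real.exp (∑ i ∈ s, -(r * d i))
      ≤ A ^ (m + 1) * (Real.exp (-(r * d₀)) * Real.exp (5 * r) ^ m) :=
        mul_le_mul_of_nonneg_left hexp (by positivity)
    _ = A * Real.exp (-(r * d₀)) * (A * Real.exp (5 * r)) ^ m := by rw [mul_pow]; ring
    _ ≤ A * Real.exp (-(r * d₀)) * 1 := mul_le_mul_of_nonneg_left hpow (by positivity)
    _ = A * Real.exp (-(r * d₀)) := mul_one _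

/-- (2.33) p. 19 [19], the case Y₀ = ∅ certified (*"the fact that if Y₀ is empty, then we have the exponential
factor"*): with N = M⁻⁴|Z₀| ≥ 1, N ≥ d_k(Z₀) + 1 (the upper half of (2.30)), `(1/20)γ₂ε₁²/g_k² =: a/20 ≥ 4κ` (R16),
κ, δ, d ≥ 0: `exp(−(a/10)N) ≤ exp(−a/20) · exp(−(1 − 4δ)κ d_k(Z₀))`. [cite: Balaban1988RG2Cluster, (2.33) p.19] -/
theorem case_empty_233 (a κ δ d N : ℝ) (hN1 : 1 ≤ N) (h230 : d + 1 ≤ N) (hκ : 0 ≤ κ) (hδ : 0 ≤ δ) (hd : 0 ≤ d)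
    (h16 : 4 * κ ≤ a / 20) :
    Real.exp (-(a / 10 * N)) ≤ Real.exp (-(a / 20)) * Real.exp (-((1 - 4 * δ) * κ * d)) := by
  rw [← Real.exp_add]
  apply Real.exp_le_exp.mpr
  have ha : 0 ≤ a / 20 := le_trans (by positivity) h16
  have h1 : a / 20 * 1 ≤ a / 20 * N := mul_le_mul_of_nonneg_left hN1 ha
  have h2 : 4 * κ * N ≤ a / 20 * N := mul_le_mul_of_nonneg_right h16 (by linarith)
  have h3 : κ * (d + 1) ≤ κ * N := mul_le_mul_of_nonneg_left h230 hκ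
  have h4 : 0 ≤ κ * d := mul_nonneg hκ hd
  have h5 : 0 ≤ δ * (κ * d) := mul_nonneg hδ h4
  nlinarith

/-- (2.34) p. 19 [19] (and the analogous sums on pp. 18, 20) certified: summing `exp(−a|W|)` over all subsets W of N
cubes gives `(1 + e^{−a})^N ≤ exp(N e^{−a})` — *"Σ_{Z₀∖Y₀} exp(−(1/20)γ₂(ε₁²/g_k²)M⁻⁴|Z₀∖Y₀|) ≤
exp(exp(−(1/20)γ₂ε₁²/γ²)M⁻⁴|Z₀|)"*. [cite: Balaban1988RG2Cluster, (2.34) p.19] -/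
theorem sum_powerset_le_exp_234 {α : Type*} [DecidableEq α] (s : Finset α) (t : ℝ) (ht : 0 ≤ t) :
    ∑ W ∈ s.powerset, t ^ W.card ≤ Real.exp ((s.card : ℝ) * t) := by
  have hsum : ∑ W ∈ s.powerset, t ^ W.card = (t + 1) ^ s.card := by
    rw [← Finset.sum_pow_mul_eq_add_pow t 1 s]
    refine Finset.sum_congr rfl fun W _ => ?_
    rw [one_pow, mul_one]
  rw [hsum, Real.exp_nat_mul]
  exact pow_le_pow_left₀ (by positivity) (Real.add_one_le_exp t) _

/-! ## Part F. The scale-transfer step (2.36): printed form, the cell's proved substitute, and the closing ledger of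
pp. 19–21 with a general transfer factor (cell GAPS.md G-B13-09R / C-B13-09; prose proof with page quotations:
`HOME/b2b-balaban-b13/GEOMETRY-236.md`, unit `b2b-balaban-b13-g2`) -/

/-- The scale-transfer inequality behind (2.36) p. 19 [19] with a general factor `ℓ`, over two abstract systems of
localization domains (scales k and k + 1, `Setup.LocDomainSys`) and the closure map `cl : Z ↦ Z′` = p. 19 *"we denote
by Z′_i the smallest localization domain from 𝐃_{k+1} containing Z̃_i"*: `ℓ · d_{k+1}(Z′) ≤ d_k(Z)` for every Z.  The
printed (2.36) is `ℓ = L/2` (`Ineq236Printed`); the cell's PROVED substitute (GEOMETRY-236.md Corollary B: d = 4,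
nested cubic partitions with L odd, any of the norms ℓ¹, ℓ², ℓ^∞ for the continuum tree length of [I] p. 257) is
`ℓ = L / Consts.aL L`, `Consts.aL L = 3 + 12/(L − 2)` (`corB_of_thmA` is its arithmetic skeleton).  Not a printed
display for general ℓ (cell DIVERGENCE.md D-b13.9). [cite: Balaban1988RG2Cluster, (2.36) p.19] -/
def Ineq236With (Dk Dk1 : LocDomainSys) (cl : Dk.Dom → Dk1.Dom) (ℓ : ℝ) : Prop :=
  ∀ Z, ℓ * Dk1.dj (cl Z) ≤ Dk.dj Z

/-- (2.36) p. 19 [19], verbatim: *"2d_k(Z_i) ≥ Ld_{k+1}(Z′_i). This inequality can be obtained by simple, but awkward,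
geometric and combinatoric considerations. It follows by considering locally many possible cases."* — the transfer
inequality with the printed factor `L/2` (UNPROVED in print and false for L ≤ 5, cell GAPS.md G-B13-09; not needed:
the certified factor `L / Consts.aL L` closes the ledger for every admitted L, `Consts.one_lt_transferFactor`). [cite: Balaban1988RG2Cluster, (2.36) p.19] -/
def Ineq236Printed (Dk Dk1 : LocDomainSys) (cl : Dk.Dom → Dk1.Dom) (L : ℕ) : Prop :=
  Ineq236With Dk Dk1 cl ((L : ℝ) / 2)

/-- The single use of (2.36), p. 20 [20] lines 2–3, verbatim: *"and (1 − 5δ)κd_k(Z_i) in the exponentials replaced by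
(1 − 6δ)½Lκd_{k+1}(Z′_i)"* (after the extraction of `exp(−δκd_k(Z_i))`, p. 19): for every rate `r ≥ 0` and transfer
factor ℓ, `exp(−r·d_k(Z)) ≤ exp(−r·ℓ·d_{k+1}(Z′))`.  Kernel-checked monotonicity. [cite: Balaban1988RG2Cluster, p.20 (after (2.36))] -/
theorem exp_transfer_of_ineq236With {Dk Dk1 : LocDomainSys} {cl : Dk.Dom → Dk1.Dom} {ℓ : ℝ}
    (h : Ineq236With Dk Dk1 cl ℓ) (r : ℝ) (hr : 0 ≤ r) (Z : Dk.Dom) :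
    Real.exp (-(r * Dk.dj Z)) ≤ Real.exp (-(r * ℓ * Dk1.dj (cl Z))) := by
  apply Real.exp_le_exp.mpr
  have hmul : r * (ℓ * Dk1.dj (cl Z)) ≤ r * Dk.dj Z := mul_le_mul_of_nonneg_left (h Z) hr
  rw [mul_assoc]
  linarith

namespace Consts

/-- The cell's certified transfer constant `a(L) = 3 + 12/(L − 2)` (GEOMETRY-236.md Corollary B:
`L·d_{k+1}(Z′) ≤ a(L)·d_k(Z)` for every connected union Z of π_k-cubes, d = 4, L ≥ 3); print claims the constant 2.
Not a printed quantity (cell DIVERGENCE.md D-b13.9). [cite: Balaban1988RG2Cluster, (2.36) p.19] -/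
def aL (L : ℝ) : ℝ := 3 + 12 / (L - 2)

/-- `a(13) = 45/11` (L = 13 is the least block size admitted by [I] p. 251, cell SMALLNESS.md S-B12.1). [cite: Balaban1988RG2Cluster, (2.36) p.19] -/
theorem aL_thirteen : aL 13 = 45 / 11 := by norm_num [aL]

/-- `a(L) > 0` for `L > 2`. [cite: Balaban1988RG2Cluster, (2.36) p.19] -/
theorem aL_pos {L : ℝ} (hL : 2 < L) : 0 < aL L := by
  unfold aL
  have h2 : 0 < L - 2 := by linarith
  positivity

/-- `a(L) < L ⟺ L > 6` (for `L > 2`): the modified closing assumption `(1 − 10δ)·(L/a(L)) = 1` of p. 21 has a solution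
`δ ∈ (0, 1/10)` exactly when `L ≥ 7` — in particular for every L admitted by [I] p. 251 *"L an odd, positive integer
> 11"*. [cite: Balaban1988RG2Cluster, p.21 (after (2.41))] -/
theorem aL_lt_self_iff {L : ℝ} (hL : 2 < L) : aL L < L ↔ 6 < L := by
  unfold aL
  have h2 : 0 < L - 2 := by linarith
  have e : (3 : ℝ) + 12 / (L - 2) = (3 * (L - 2) + 12) / (L - 2) := by
    field_simp
  rw [e, div_lt_iff₀ h2]
  constructor
  · intro h
    nlinarith
  · intro h
    nlinarith

/-- The certified transfer factor `L/a(L)` exceeds 1 for `L > 6` (so `δ > 0` is available, `delta_bounds_of_R22gen`). [cite: Balaban1988RG2Cluster, p.21 (after (2.41))] -/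
theorem one_lt_transferFactor {L : ℝ} (hL : 6 < L) : 1 < L / aL L := by
  have ha : 0 < aL L := aL_pos (by linarith)
  rw [lt_div_iff₀ ha, one_mul]
  exact (aL_lt_self_iff (by linarith)).mpr hL

/-- At L = 13 the certified transfer factor is `13/a(13) = 143/45 = 3.17…` (printed: ½L = 6.5). [cite: Balaban1988RG2Cluster, p.21 (after (2.41))] -/
theorem transferFactor_thirteen : (13 : ℝ) / aL 13 = 143 / 45 := by
  rw [aL_thirteen]
  norm_num

/-- The first "last assumption" of p. 21 [21] (*"(1 − 10δ)½L = 1"*, `R22`) with a general transfer factor ℓ in place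
of ½L: `(1 − 10δ)ℓ = 1` (certified reading: ℓ = L / aL L; cell GAPS.md C-B13-09).  Not printed for general ℓ. [cite: Balaban1988RG2Cluster, p.21 (after (2.41))] -/
def R22gen (c : Consts) (ℓ : ℝ) : Prop := (1 - 10 * c.δ) * ℓ = 1

/-- `R22gen (L/2)` is literally the printed `R22`. [cite: Balaban1988RG2Cluster, p.21 (after (2.41))] -/
theorem R22gen_half_iff (c : Consts) : c.R22gen ((c.L : ℝ) / 2) ↔ c.R22 := Iff.rfl

/-- `(1 − 10δ)ℓ = 1 ⟺ δ = (1/10)(1 − ℓ⁻¹)` (the p. 21 "or", for general ℓ ≠ 0). [cite: Balaban1988RG2Cluster, p.21 (after (2.41))] -/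
theorem R22gen_iff_delta (c : Consts) {ℓ : ℝ} (hℓ : ℓ ≠ 0) : c.R22gen ℓ ↔ c.δ = (1 - 1 / ℓ) / 10 := by
  unfold R22gen
  constructor
  · intro h
    have h' : c.δ * ℓ = (ℓ - 1) / 10 := by linear_combination (-1 / 10 : ℝ) * h
    have : c.δ = c.δ * ℓ / ℓ := by field_simp
    rw [this, h']
    field_simp
  · intro h
    rw [h]
    field_simp
    ring

/-- With a transfer factor ℓ > 1 the closing assumption forces `0 < δ < 1/10`, so all rates `(1 − jδ)`, j ≤ 10, of
(2.18)–(2.41) are positive (for ℓ = L / aL L and L ≥ 7: `one_lt_transferFactor`). [cite: Balaban1988RG2Cluster, p.21 (after (2.41))] -/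
theorem delta_bounds_of_R22gen (c : Consts) {ℓ : ℝ} (hℓ : 1 < ℓ) (h : c.R22gen ℓ) : 0 < c.δ ∧ c.δ < 1 / 10 := by
  unfold R22gen at h
  have hℓ0 : 0 < ℓ := by linarith
  have h' : c.δ * ℓ = (ℓ - 1) / 10 := by linear_combination (-1 / 10 : ℝ) * h
  constructor
  · by_contra hc
    rw [not_lt] at hc
    have : c.δ * ℓ ≤ 0 := mul_nonpos_of_nonpos_of_nonneg hc hℓ0.le
    linarith
  · by_contra hc
    rw [not_lt] at hc
    have : (1 / 10 : ℝ) * ℓ ≤ c.δ * ℓ := mul_le_mul_of_nonneg_right hc hℓ0.le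
    linarith

/-- Conversely the transfer factor MUST exceed 1: under `(1 − 10δ)ℓ = 1` with ℓ > 0, `δ > 0 ⟺ ℓ > 1` (so a transfer
inequality with factor ≤ 1 — e.g. the trivial `d_{k+1}(Z′) ≤ d_k(Z)`-type bounds — cannot close the ledger). [cite: Balaban1988RG2Cluster, p.21 (after (2.41))] -/
theorem delta_pos_iff_of_R22gen (c : Consts) {ℓ : ℝ} (hℓ : 0 < ℓ) (h : c.R22gen ℓ) : 0 < c.δ ↔ 1 < ℓ := by
  unfold R22gen at h
  have h' : c.δ * ℓ = (ℓ - 1) / 10 := by linear_combination (-1 / 10 : ℝ) * h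
  constructor
  · intro hδ
    have := mul_pos hδ hℓ
    linarith
  · intro h1
    by_contra hc
    rw [not_lt] at hc
    have : c.δ * ℓ ≤ 0 := mul_nonpos_of_nonpos_of_nonneg hc hℓ.le
    linarith

/-- The merging-rate arithmetic of cell GAPS.md G-B13-10 with a general transfer factor: under `(1 − 10δ)ℓ = 1`,
`(1 − 6δ)ℓ = 1 + 4δℓ`, `(1 − 7δ)ℓ = 1 + 3δℓ`, `(1 − 9δ)ℓ = 1 + δℓ` — so the factors produced by (2.27) at scale k + 1
on p. 20 and in (2.39) are `exp 5(1 + jδℓ)κ` per extra domain, not the printed `exp 5κ` (absorbed by "ε₁ sufficiently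
small"; `rate239_of_R22` is the case ℓ = L/2, j = 1). [cite: Balaban1988RG2Cluster, (2.37) p.20 and (2.39) p.21] -/
theorem rates_of_R22gen (c : Consts) {ℓ : ℝ} (h : c.R22gen ℓ) :
    (1 - 6 * c.δ) * ℓ = 1 + 4 * c.δ * ℓ ∧ (1 - 7 * c.δ) * ℓ = 1 + 3 * c.δ * ℓ ∧
      (1 - 9 * c.δ) * ℓ = 1 + c.δ * ℓ := by
  unfold R22gen at h
  exact ⟨by linear_combination h, by linear_combination h, by linear_combination h⟩

end Consts

/-- GEOMETRY-236.md Theorem A, the accounting step kernel-checked (the geometry — tree decomposition, the common face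
of the ≤ 2^d cells seen by a short piece, the tree median — is prose there): if the shortest tree (length τ) of Z is
cut into pieces i ∈ s of lengths `w i ≥ 0` with `Σ w i = τ` and `(#s − 1)·λ ≤ 2τ` (all pieces but one have length
≥ λ/2), and the whisker hung on piece i has length `wh i ≤ 2·w i + 4M`, then the coarse tree has length
`≤ τ + Σ wh i ≤ 3τ + 4M + 8Mτ/λ`; with λ = (L − 2)M this is `M·((3 + 8/(L−2))·d_k(Z) + 4)`. [cite: Balaban1988RG2Cluster, (2.36) p.19] -/
theorem thmA_accounting {ι : Type*} (s : Finset ι) (w wh : ι → ℝ) (τ M lam : ℝ) (hM : 0 ≤ M) (hlam : 0 < lam)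
    (hsum : ∑ i ∈ s, w i = τ) (hN : ((s.card : ℝ) - 1) * lam ≤ 2 * τ)
    (hwh : ∀ i ∈ s, wh i ≤ 2 * w i + 4 * M) :
    τ + ∑ i ∈ s, wh i ≤ 3 * τ + 4 * M + 8 * M * τ / lam := by
  have h1 : ∑ i ∈ s, wh i ≤ ∑ i ∈ s, (2 * w i + 4 * M) := Finset.sum_le_sum hwh
  have h2 : ∑ i ∈ s, (2 * w i + 4 * M) = 2 * τ + (s.card : ℝ) * (4 * M) := by
    rw [Finset.sum_add_distrib, ← Finset.mul_sum, hsum, Finset.sum_const, nsmul_eq_mul]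
  have hcard : (s.card : ℝ) - 1 ≤ 2 * τ / lam := by
    rw [le_div_iff₀ hlam]
    linarith
  have h3 : (s.card : ℝ) * (4 * M) ≤ (1 + 2 * τ / lam) * (4 * M) :=
    mul_le_mul_of_nonneg_right (by linarith) (by positivity)
  have e : (1 + 2 * τ / lam) * (4 * M) = 4 * M + 8 * M * τ / lam := by ring
  linarith

/-- GEOMETRY-236.md Corollary B from Theorem A and Lemma 1 ("two scales apart": `d_{k+1}(Z′) > 0 ⇒ d_k(Z) ≥ L − 2`),
the arithmetic kernel-checked: for `L > 2`, `0 ≤ d`, `0 ≤ d′`, Theorem A `L·d′ ≤ (3 + 8/(L−2))·d + 4` and Lemma 1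
give `L·d′ ≤ a(L)·d`, i.e. the transfer inequality `Ineq236With … (L / a(L))` pointwise. [cite: Balaban1988RG2Cluster, (2.36) p.19] -/
theorem corB_of_thmA {L d d' : ℝ} (hL : 2 < L) (hd : 0 ≤ d) (hd' : 0 ≤ d')
    (hA : L * d' ≤ (3 + 8 / (L - 2)) * d + 4) (h1 : 0 < d' → L - 2 ≤ d) :
    L * d' ≤ Consts.aL L * d := by
  unfold Consts.aL
  have h2 : 0 < L - 2 := by linarith
  rcases hd'.eq_or_lt with h0 | hpos
  · rw [← h0, mul_zero]
    have : (0 : ℝ) ≤ 3 + 12 / (L - 2) := by positivity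
    exact mul_nonneg this hd
  · have hLd : L - 2 ≤ d := h1 hpos
    have h4 : (4 : ℝ) ≤ 4 * d / (L - 2) := by
      rw [le_div_iff₀ h2]
      linarith
    calc L * d' ≤ (3 + 8 / (L - 2)) * d + 4 := hA
      _ ≤ (3 + 8 / (L - 2)) * d + 4 * d / (L - 2) := by linarith
      _ = (3 + 12 / (L - 2)) * d := by ring

/-- From the pointwise form to the transfer inequality with the certified factor: if `a·L′ = L`-type bookkeeping —
precisely, if for every Z `L·d_{k+1}(Z′) ≤ a·d_k(Z)` with `a > 0`, then `Ineq236With … (L/a)`. [cite: Balaban1988RG2Cluster, (2.36) p.19] -/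
theorem ineq236With_of_pointwise {Dk Dk1 : LocDomainSys} {cl : Dk.Dom → Dk1.Dom} {L a : ℝ} (ha : 0 < a)
    (h : ∀ Z, L * Dk1.dj (cl Z) ≤ a * Dk.dj Z) : Ineq236With Dk Dk1 cl (L / a) := by
  intro Z
  have hZ := h Z
  rw [div_mul_eq_mul_div, div_le_iff₀ ha]
  linarith [mul_comm a (Dk.dj Z)]

/-- (2.38) of Lemma 3 with a general transfer factor ℓ in place of ½L: `|H(Z)| ≤ C₃ε₁ exp(−(1 − 8δ)ℓκd_{k+1}(Z))`
(printed ℓ = L/2 = `Bound238`, `bound238With_half`; certified reading ℓ = L / aL L, cell GAPS.md C-B13-09).  Not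
printed for general ℓ. [cite: Balaban1988RG2Cluster, (2.38) p.20] -/
def Bound238With (S : StepData) (c : Consts) (ℓ : ℝ) : Prop :=
  ∀ Z φ, φ ∈ S.sp2 Z → ‖S.H Z φ‖ ≤
    c.C3act * c.ε₁ * Real.exp (-((1 - 8 * c.δ) * ℓ * c.κ * S.Dk1.dj Z))

/-- `Bound238With … (L/2)` is literally the printed (2.38). [cite: Balaban1988RG2Cluster, (2.38) p.20] -/
theorem bound238With_half (S : StepData) (c : Consts) : Bound238With S c ((c.L : ℝ) / 2) ↔ Bound238 S c := Iff.rfl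

/-- (2.41) with a general transfer factor ℓ in place of ½L: `|E^{(k+1)}(X)| ≤ O(1)C₃ε₁ exp(−(1 − 10δ)ℓκd_{k+1}(X))`
(printed ℓ = L/2 = `Bound241`).  Not printed for general ℓ. [cite: Balaban1988RG2Cluster, (2.41) p.21] -/
def Bound241With (S : StepData) (c : Consts) (ℓ : ℝ) : Prop :=
  ∀ X φ, φ ∈ S.sp2 X → ‖S.Ek1 X φ‖ ≤
    c.A₂ * c.C3act * c.ε₁ * Real.exp (-((1 - 10 * c.δ) * ℓ * c.κ * S.Dk1.dj X))

/-- `Bound241With … (L/2)` is literally the printed (2.41). [cite: Balaban1988RG2Cluster, (2.41) p.21] -/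
theorem bound241With_half (S : StepData) (c : Consts) : Bound241With S c ((c.L : ℝ) / 2) ↔ Bound241 S c := Iff.rfl

/-- Lemma 3 with a general transfer factor (`Lemma3Printed` is ℓ = L/2); `S.Restr` = the restrictions, which in the
certified reading carry ℓ in place of ½L at R19, R20, R22 (cell census; GEOMETRY-236.md §4). [cite: Balaban1988RG2Cluster, Lemma 3 p.20] -/
def Lemma3With (S : StepData) (c : Consts) (ℓ : ℝ) : Prop := S.Restr → Bound238With S c ℓ

/-- The [26]-resummation step (2.38) ⇒ (2.41) with a general transfer factor (`CammarotaStep` is ℓ = L/2; cell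
GAPS.md G-B13-11 unchanged). [cite: Balaban1988RG2Cluster, (2.39)–(2.41) p.21] -/
def CammarotaStepWith (S : StepData) (c : Consts) (ℓ : ℝ) : Prop := Bound238With S c ℓ → Bound241With S c ℓ

/-- p. 21 [21] *"The inequality (2.41) and the assumptions imply the inequality (I.1.18), with ½E₀ instead of E₀"* —
for ANY transfer factor ℓ: (2.41)_ℓ ∧ `(1 − 10δ)ℓ = 1` ∧ `O(1)C₃ε₁ ≤ ½E₀` ⇒ `|E^{(k+1)}(X)| ≤ ½E₀ exp(−κd_{k+1}(X))`.
With ℓ = L / aL L this is the certified closing of §2 (cell GAPS.md C-B13-09); `bound118_of_bound241` is ℓ = L/2. [cite: Balaban1988RG2Cluster, p.21 (after (2.41))] -/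
theorem bound118_of_bound241With (S : StepData) (c : Consts) {ℓ : ℝ} (h241 : Bound241With S c ℓ)
    (h22 : c.R22gen ℓ) (h23 : c.R23) : Bound118 S.Dk1 S.sp2 S.Ek1 (c.E₀ / 2) c.κ := by
  intro X φ hφ
  have hrate : (1 - 10 * c.δ) * ℓ * c.κ * S.Dk1.dj X = c.κ * S.Dk1.dj X := by
    have h22' : (1 - 10 * c.δ) * ℓ = 1 := h22
    rw [h22', one_mul]
  have h23' : c.A₂ * c.C3act * c.ε₁ ≤ c.E₀ / 2 := h23
  have h := h241 X φ hφ
  rw [hrate] at h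
  have hexp : 0 ≤ Real.exp (-(c.κ * S.Dk1.dj X)) := (Real.exp_pos _).le
  calc ‖S.Ek1 X φ‖ ≤ c.A₂ * c.C3act * c.ε₁ * Real.exp (-(c.κ * S.Dk1.dj X)) := h
    _ ≤ c.E₀ / 2 * Real.exp (-(c.κ * S.Dk1.dj X)) := mul_le_mul_of_nonneg_right h23' hexp
    _ = c.E₀ / 2 * Real.exp (-c.κ * S.Dk1.dj X) := by rw [neg_mul]

/-- The §2 chain with a general transfer factor ℓ (`deliverables_of_chain` is ℓ = L/2): restrictions + Lemma 3_ℓ + the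
[26]-step_ℓ + `(1 − 10δ)ℓ = 1` + `O(1)C₃ε₁ ≤ ½E₀` + the log Z^{(k)} half with `δ₀M ≥ κ` + analyticity, gauge
invariance, (I.1.7) ⇒ the delivered clauses for A_{k+1}, whose decay rate is κ independently of ℓ.  With
ℓ = L / aL L, L ≥ 7, every input is either printed-and-audited or PROVED in GEOMETRY-236.md. [cite: Balaban1988RG2Cluster, pp.20–22 (Lemma 3 to Thm I.3)] -/
theorem deliverables_of_chainWith (S : StepData) (c : Consts) {ℓ : ℝ} (hR : S.Restr) (h3 : Lemma3With S c ℓ)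
    (h26 : CammarotaStepWith S c ℓ) (h22 : c.R22gen ℓ) (h23 : c.R23) (h24 : c.R24) (hE₀ : 0 ≤ c.E₀)
    (hlog : Bound118 S.Dk1 S.sp2 S.Elog (c.E₀ / 2) (c.δ₀ * c.M)) (hrepr : S.Repr17)
    (han : ∀ X, S.Analytic (S.Etot X) (S.sp2 X)) (hg : ∀ X, S.GaugeInv (S.Etot X)) :
    Deliverables S c where
  repr := hrepr
  analytic := han
  bound := bound118_of_halves S.Dk1 S.sp2 S.Etot S.Ek1 S.Elog c.E₀ c.κ (c.δ₀ * c.M) hE₀ h24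
    (fun _ _ _ => rfl) (bound118_of_bound241With S c (h26 (h3 hR)) h22 h23) hlog
  gauge := hg


/-! ## Part G. The log Z^{(k)} half of (I.1.18): the by-reference localisation bound typed as named leaves
(unit b2b-balaban-b13-g3; cell GAPS.md G-B13-12, G-adv5-5, G-B13-12a)

p. 21 [21], verbatim: *"The effective action in (I.1.6) is obtained by adding to the above action the expression
[log Z^{(k)}(U_{k+1}) − log Z^{(k)}(1)]. For this expression we construct the representation (I.1.7) using the
generalized random walk expansion for Z^{(k)}(U_{k+1}). The expansion was constructed in [16], see the formula (63)
there, and the discussion after it. We gather all terms in the expansions, localized in X, and we extend them to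
analytic functions of 𝐔, 𝐉. The expression localized in X satisfies the bound (I.1.18) with κ replaced by δ₀M, and
with an absolute constant instead of E₀. We define ½E₀ as equal to this constant, and we take M sufficiently large, so
that δ₀M ≥ κ."*  Parts D/F consume this half as the bare hypothesis `hlog : Bound118 … Elog (E₀/2) (δ₀M)`.  Neither
[16] = [Balaban1985UV3] ((63) p. 272 there and "the discussion after it": the U_{k+1} = 1 part is cancelled by the second
term of (61); the remaining terms "are analyzed in the way described before", i.e. by the volume bounds (44)–(46),
d = 3) nor this paper PRINTS the estimate used — cell GAPS.md G-B13-12 (located), G-adv5-5 (sharpened: for X = one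
LM-cube the localised terms are sums over (LM)⁴ sites, so an X-independent ABSOLUTE constant needs a PER-SITE smallness
of the U-dependent difference, which is written nowhere).  This Part types the missing estimate as a NAMED LEAF in the
one shape both readings of the word "absolute" share — a per-LM-cube constant `B` times the number `nX X` of LM-cubes
of X times `exp(−r d_{k+1}(X))` (`LogHalfBound`) — together with the (2.30)-type volume bound at scale k + 1
(`VolBoundK1`, repaired form, GAPS.md G-B13-07) that converts it into the shape (I.1.18) at the cost of ONE unit of
decay rate (`bound118_of_logHalfBound`: `1 + d ≤ exp d`), the printed restriction (LM)⁴α₀, … ≤ 1 of p. 20 (`Consts.R21`)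
under which the literal reading holds, and the sharpened form `κ + 1 ≤ δ₀M` of the printed `δ₀M ≥ κ` that the lost unit
of rate requires (`Consts.R24sharp`; "M sufficiently large" — harmless in the admissible order, cell GAPS.md C-adv2-3).
`deliverables_of_chainWith_logHalf` is `deliverables_of_chainWith` with `hlog` DISCHARGED modulo these leaves.
The two readings (recorded, NOT decided — cell GAPS.md G-B13-12a): (a) LITERAL — `B = A·θ·(LM)⁴` with A absolute and a
per-site smallness θ = O(α₀ + α₁) of the difference of resolvents for (𝐔, 𝐉) ∈ Uᶜ_{k+1}(X, α₀, α₁), so that R21 gives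
`B ≤ A` and `½E₀ := A·c₁` is absolute (the unprinted lemma of G-adv5-5); (b) ORDER-ADMISSIBLE — `B = A·(LM)⁴` with no
smallness (O(1) per site, which is all that (44)–(46) of [16] assert), so that `½E₀ := A·c₁·(LM)⁴` depends on L, M:
this contradicts the adjective "absolute" but not the logic of Theorem I.3, whose (1.18) reads ([Balaban1987RG1]
p. 262) *"There exists a constant E_0 such that (1.18) …"* and whose constant list (Theorem 3 p. 264: *"positive
constants κ_0, M(κ), γ, ε_0, ε_1, α_0, α_1 … The constants ε_0, ε_1, α_0, α_1 depend on M"*) fixes E₀ after M, every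
restriction of this paper containing E₀ being either a lower bound (R12 `C₃ ≤ E₀C₁`) or E₀-free after cancellation
(R15, R23: `Consts.R23_iff`) — the restrictions of [I] §§2–5 are not re-audited here.  Nothing is asserted: the leaf is
a hypothesis in both readings. -/

namespace Consts

/-- Restriction p. 20 [20], verbatim: *"We assume that (LM)⁴α₀, (LM)⁴α₁, (LM)⁴α₄, (LM)⁴γ₂ are bounded by a constant
independent of M, for example by 1. Then O(1)(LM)⁴α₅ + exp(−½(κ₁ − 1)) is bounded by an absolute constant"* (cell
census R21; the only printed per-site smallness × volume-of-an-LM-cube bookkeeping in the paper, invoked by reading (a)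
of Part G). [cite: Balaban1988RG2Cluster, p.20 (before the definition of C₃)] -/
def R21 (c : Consts) : Prop :=
  ((c.L : ℝ) * c.M) ^ 4 * c.α₀ ≤ 1 ∧ ((c.L : ℝ) * c.M) ^ 4 * c.α₁ ≤ 1 ∧
    ((c.L : ℝ) * c.M) ^ 4 * c.α₄ ≤ 1 ∧ ((c.L : ℝ) * c.M) ^ 4 * c.γ₂ ≤ 1

/-- NOT PRINTED (the printed restriction is `R24`: *"we take M sufficiently large, so that δ₀M ≥ κ"*, p. 21): the form
`κ + 1 ≤ δ₀M` needed when the log Z^{(k)} half is delivered per LM-cube (`LogHalfBound`) and the cube count is absorbed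
into the rate by `1 + d ≤ exp d` (`bound118_of_logHalfBound`).  Same place in the admissible order (M after κ);
implies `R24` (`R24_of_R24sharp`). [cite: Balaban1988RG2Cluster, p.21 (closing paragraph)] -/
def R24sharp (c : Consts) : Prop := c.κ + 1 ≤ c.δ₀ * c.M

/-- `κ + 1 ≤ δ₀M ⇒ δ₀M ≥ κ`. [cite: Balaban1988RG2Cluster, p.21 (closing paragraph)] -/
theorem R24_of_R24sharp (c : Consts) (h : c.R24sharp) : c.R24 := by
  unfold R24; unfold R24sharp at h; linarith

/-- Reading (a) bookkeeping: under R21 a per-site constant `A·θ` with `θ ≤ α₀ + α₁` summed over the `(LM)⁴` sites of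
one LM-cube is at most `2A` — the arithmetic by which p. 20 turns "(LM)⁴α₅" into "an absolute constant", applied to
the log Z^{(k)} half (cell GAPS.md G-adv5-5 REPAIR).  Real arithmetic only; the per-site bound itself is NOT printed. [cite: Balaban1988RG2Cluster, p.20 (before the definition of C₃)] -/
theorem perSite_absolute_of_R21 (c : Consts) (h : c.R21) {A θ : ℝ} (hA : 0 ≤ A) (hθ : θ ≤ c.α₀ + c.α₁) :
    A * θ * ((c.L : ℝ) * c.M) ^ 4 ≤ 2 * A := by
  obtain ⟨h0, h1, -, -⟩ := h
  have hv : 0 ≤ ((c.L : ℝ) * c.M) ^ 4 := by positivity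
  have hθv : θ * ((c.L : ℝ) * c.M) ^ 4 ≤ 2 := by
    calc θ * ((c.L : ℝ) * c.M) ^ 4 ≤ (c.α₀ + c.α₁) * ((c.L : ℝ) * c.M) ^ 4 := mul_le_mul_of_nonneg_right hθ hv
      _ = ((c.L : ℝ) * c.M) ^ 4 * c.α₀ + ((c.L : ℝ) * c.M) ^ 4 * c.α₁ := by ring
      _ ≤ 1 + 1 := add_le_add h0 h1
      _ = 2 := by norm_num
  calc A * θ * ((c.L : ℝ) * c.M) ^ 4 = A * (θ * ((c.L : ℝ) * c.M) ^ 4) := by ring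
    _ ≤ A * 2 := mul_le_mul_of_nonneg_left hθv hA
    _ = 2 * A := by ring

end Consts

/-- THE LEAF (not printed in the series; cell GAPS.md G-B13-12 / G-adv5-5): the localised terms of
`log Z^{(k)}(U_{k+1}) − log Z^{(k)}(1)` attached to X ∈ 𝐃_{k+1} (p. 21: *"We gather all terms in the expansions, localized
in X"*) obey `|Elog(X)| ≤ B · nX(X) · exp(−r d_{k+1}(X))` on the spaces `sp X`, where `nX X` = (LM)⁻⁴|X| = the number of
LM-cubes (unit cubes of T₁^{(k+1)}) in X, `B` = a per-LM-cube constant and `r` = the decay rate (printed: r = δ₀M,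
*"with κ replaced by δ₀M"*).  This is the shape a random-walk expansion of [13]/[16]-type delivers term by term
(each site of X carries one resolvent term; [16] (44)–(46) are volume bounds); whether `B` is absolute (reading (a),
per-site smallness + `Consts.R21`) or O((LM)⁴) (reading (b)) is exactly the open point G-B13-12a.  Hypothesis only. [cite: Balaban1988RG2Cluster, p.21 (closing paragraph)] -/
def LogHalfBound (D : LocDomainSys) {Φ : Type*} (sp : D.Dom → Set Φ) (Elog : D.Dom → Φ → ℂ) (nX : D.Dom → ℕ)
    (B r : ℝ) : Prop :=
  ∀ X φ, φ ∈ sp X → ‖Elog X φ‖ ≤ B * (nX X : ℝ) * Real.exp (-(r * D.dj X))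

/-- The volume bound at scale k + 1 in the REPAIRED form of (2.30) p. 18 (printed: *"(3·2³)⁻¹M⁻⁴|Y| ≤ d_k(Y)"*, false for
a single cube; repaired `M⁻⁴|Y| ≤ c₁(1 + d_k(Y))`, cell GAPS.md G-B13-07; same shape as `B13FamilySum.VolBound` of the
sibling module, here for one cube-count function at scale k + 1): `nX X ≤ c₁ (1 + d_{k+1}(X))`.  Hypothesis (geometry of
unions of cubes is not modelled, DIVERGENCE F5). [cite: Balaban1988RG2Cluster, (2.30) p.18] -/
def VolBoundK1 (D : LocDomainSys) (nX : D.Dom → ℕ) (c₁ : ℝ) : Prop := ∀ X, (nX X : ℝ) ≤ c₁ * (1 + D.dj X)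

/-- Monotonicity of the shape (I.1.18) in its two constants (larger E₀, smaller rate), using d_{k+1} ≥ 0. [folklore] -/
theorem bound118_mono {Φ : Type*} (D : LocDomainSys) (sp : D.Dom → Set Φ) (E : D.Dom → Φ → ℂ) {E₀ E₀' κ κ' : ℝ}
    (hE : E₀ ≤ E₀') (hκ : κ' ≤ κ) (hE₀' : 0 ≤ E₀') (h : Bound118 D sp E E₀ κ) : Bound118 D sp E E₀' κ' := by
  intro X φ hφ
  have hd : 0 ≤ D.dj X := D.dj_nonneg X
  have hexp : Real.exp (-κ * D.dj X) ≤ Real.exp (-κ' * D.dj X) :=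
    Real.exp_le_exp.mpr (mul_le_mul_of_nonneg_right (neg_le_neg hκ) hd)
  calc ‖E X φ‖ ≤ E₀ * Real.exp (-κ * D.dj X) := h X φ hφ
    _ ≤ E₀' * Real.exp (-κ * D.dj X) := mul_le_mul_of_nonneg_right hE (Real.exp_pos _).le
    _ ≤ E₀' * Real.exp (-κ' * D.dj X) := mul_le_mul_of_nonneg_left hexp hE₀'

/-- The conversion the printed sentence performs silently: a per-LM-cube bound `B · nX(X) · e^{−r d(X)}` and the volume
bound `nX(X) ≤ c₁(1 + d(X))` give the shape (I.1.18) with constant `B·c₁` and rate `r − 1`, by `1 + d ≤ exp d`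
(`Real.add_one_le_exp`).  Real arithmetic; kernel-checked. [cite: Balaban1988RG2Cluster, p.21 (closing paragraph)] -/
theorem bound118_of_logHalfBound {Φ : Type*} (D : LocDomainSys) (sp : D.Dom → Set Φ) (Elog : D.Dom → Φ → ℂ)
    (nX : D.Dom → ℕ) {B r c₁ : ℝ} (hB : 0 ≤ B) (hlog : LogHalfBound D sp Elog nX B r)
    (hvol : VolBoundK1 D nX c₁) : Bound118 D sp Elog (B * c₁) (r - 1) := by
  intro X φ hφ
  have hd : 0 ≤ D.dj X := D.dj_nonneg X
  have hn : (0 : ℝ) ≤ (nX X : ℝ) := Nat.cast_nonneg _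
  have hv : (nX X : ℝ) ≤ c₁ * (1 + D.dj X) := hvol X
  have hc₁ : 0 ≤ c₁ := by
    by_contra hc
    rw [not_le] at hc
    have : c₁ * (1 + D.dj X) < 0 := mul_neg_of_neg_of_pos hc (by linarith)
    linarith
  have he : 1 + D.dj X ≤ Real.exp (D.dj X) := by
    have := Real.add_one_le_exp (D.dj X); linarith
  have hexp : 0 ≤ Real.exp (-(r * D.dj X)) := (Real.exp_pos _).le
  have hkey : (nX X : ℝ) ≤ c₁ * Real.exp (D.dj X) := le_trans hv (mul_le_mul_of_nonneg_left he hc₁)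
  calc ‖Elog X φ‖ ≤ B * (nX X : ℝ) * Real.exp (-(r * D.dj X)) := hlog X φ hφ
    _ ≤ B * (c₁ * Real.exp (D.dj X)) * Real.exp (-(r * D.dj X)) :=
        mul_le_mul_of_nonneg_right (mul_le_mul_of_nonneg_left hkey hB) hexp
    _ = B * c₁ * (Real.exp (D.dj X) * Real.exp (-(r * D.dj X))) := by ring
    _ = B * c₁ * Real.exp (-(r - 1) * D.dj X) := by
        rw [← Real.exp_add]; congr 1; ring

/-- Reading (a) of p. 21's "absolute constant", as bookkeeping: if the per-LM-cube constant factors as `A · θ · (LM)⁴`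
with `θ ≤ α₀ + α₁` (a per-site smallness — NOT printed, cell GAPS.md G-adv5-5 REPAIR) then under `Consts.R21` the shape
(I.1.18) holds with the ABSOLUTE constant `2A·c₁` and rate `r − 1`. [cite: Balaban1988RG2Cluster, pp.20–21 (R21 and the closing paragraph)] -/
theorem bound118_of_logHalfBound_literal {Φ : Type*} (D : LocDomainSys) (sp : D.Dom → Set Φ)
    (Elog : D.Dom → Φ → ℂ) (nX : D.Dom → ℕ) (c : Consts) {A θ r c₁ : ℝ} (hA : 0 ≤ A) (hθ0 : 0 ≤ θ)
    (hθ : θ ≤ c.α₀ + c.α₁) (h21 : c.R21) (hc₁ : 0 ≤ c₁)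
    (hlog : LogHalfBound D sp Elog nX (A * θ * ((c.L : ℝ) * c.M) ^ 4) r) (hvol : VolBoundK1 D nX c₁) :
    Bound118 D sp Elog (2 * A * c₁) (r - 1) := by
  have hB : 0 ≤ A * θ * ((c.L : ℝ) * c.M) ^ 4 := by positivity
  have h := bound118_of_logHalfBound D sp Elog nX hB hlog hvol
  have hle : A * θ * ((c.L : ℝ) * c.M) ^ 4 * c₁ ≤ 2 * A * c₁ :=
    mul_le_mul_of_nonneg_right (Consts.perSite_absolute_of_R21 c h21 hA hθ) hc₁
  exact bound118_mono D sp Elog hle le_rfl (by positivity) h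

/-- The §2 chain with a general transfer factor ℓ AND the log Z^{(k)} half discharged modulo the named leaves of this
Part: restrictions + Lemma 3_ℓ + the [26]-step_ℓ + `(1 − 10δ)ℓ = 1` + `O(1)C₃ε₁ ≤ ½E₀` + [`LogHalfBound` with the printed
rate δ₀M + `VolBoundK1` + *"We define ½E₀ as equal to this constant"* in the form `B·c₁ ≤ ½E₀` + `κ + 1 ≤ δ₀M`] +
analyticity, gauge invariance, (I.1.7) ⇒ the delivered clauses for A_{k+1} with rate κ.  Compared with
`deliverables_of_chainWith` the bare `hlog` is replaced by the four bracketed inputs; which reading of "absolute" fixes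
`B` is cell GAPS.md G-B13-12a.  Pure bookkeeping over Parts D/F. [cite: Balaban1988RG2Cluster, pp.20–22 (Lemma 3 to Thm I.3)] -/
theorem deliverables_of_chainWith_logHalf (S : StepData) (c : Consts) {ℓ : ℝ} (nX : S.Dk1.Dom → ℕ) {B c₁ : ℝ}
    (hR : S.Restr) (h3 : Lemma3With S c ℓ) (h26 : CammarotaStepWith S c ℓ) (h22 : c.R22gen ℓ) (h23 : c.R23)
    (h24 : c.R24sharp) (hE₀ : 0 ≤ c.E₀) (hB : 0 ≤ B)
    (hlogB : LogHalfBound S.Dk1 S.sp2 S.Elog nX B (c.δ₀ * c.M)) (hvol : VolBoundK1 S.Dk1 nX c₁)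
    (hE₀def : B * c₁ ≤ c.E₀ / 2) (hrepr : S.Repr17)
    (han : ∀ X, S.Analytic (S.Etot X) (S.sp2 X)) (hg : ∀ X, S.GaugeInv (S.Etot X)) :
    Deliverables S c where
  repr := hrepr
  analytic := han
  bound :=
    have h24' : c.κ ≤ c.δ₀ * c.M - 1 := by have h := h24; unfold Consts.R24sharp at h; linarith
    have hE2 : 0 ≤ c.E₀ / 2 := by linarith
    bound118_of_halves S.Dk1 S.sp2 S.Etot S.Ek1 S.Elog c.E₀ c.κ (c.δ₀ * c.M - 1) hE₀ h24'
      (fun _ _ _ => rfl) (bound118_of_bound241With S c (h26 (h3 hR)) h22 h23)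
      (bound118_mono S.Dk1 S.sp2 S.Elog hE₀def le_rfl hE2 (bound118_of_logHalfBound S.Dk1 S.sp2 S.Elog nX hB hlogB hvol))
  gauge := hg

/-- The printed-ℓ instance (ℓ = L/2, `Lemma3Printed`, `CammarotaStep`, `R22`) of `deliverables_of_chainWith_logHalf`:
`deliverables_of_chain` with `hlog` discharged modulo the leaves of Part G. [cite: Balaban1988RG2Cluster, pp.20–22 (Lemma 3 to Thm I.3)] -/
theorem deliverables_of_chain_logHalf (S : StepData) (c : Consts) (nX : S.Dk1.Dom → ℕ) {B c₁ : ℝ}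
    (hR : S.Restr) (h3 : Lemma3Printed S c) (h26 : CammarotaStep S c) (h22 : c.R22) (h23 : c.R23)
    (h24 : c.R24sharp) (hE₀ : 0 ≤ c.E₀) (hB : 0 ≤ B)
    (hlogB : LogHalfBound S.Dk1 S.sp2 S.Elog nX B (c.δ₀ * c.M)) (hvol : VolBoundK1 S.Dk1 nX c₁)
    (hE₀def : B * c₁ ≤ c.E₀ / 2) (hrepr : S.Repr17)
    (han : ∀ X, S.Analytic (S.Etot X) (S.sp2 X)) (hg : ∀ X, S.GaugeInv (S.Etot X)) :
    Deliverables S c :=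
  deliverables_of_chainWith_logHalf S c (ℓ := (c.L : ℝ) / 2) nX hR h3 h26 h22 h23 h24 hE₀ hB hlogB hvol hE₀def
    hrepr han hg

end

end Literature.MathematicalPhysics.QuantumFieldTheory.Balaban1983to89.B13
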